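import Summits.SmoothPoincare4.SmoothPoincare4.Theorems.SblfDescentRungOneHelperAnnTwistMaps
import Summits.SmoothPoincare4.SmoothPoincare4.Theorems.SblfDescentRungOneHelperAnnSmale
import Summits.SmoothPoincare4.SmoothPoincare4.Theorems.SblfDescentRungOneHelperAnnFrame
import Literature.Topology.FourManifolds.LoopRealisation
import Mathlib.Analysis.SpecialFunctions.SmoothTransition
import HarnessLib

/-!
# A diffeomorphism of the annulus is isotopic to a twist power rel a small disc (annulus twist, layer 4)

Auxiliary file (layer 4) of helper `helper_sliceGluing_annulusTwist`, line `Sketch`, crux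
`SblfDescent.RungOne`.

(Crux item stmt-SmoothPoincare4-18531; skeleton `Cruxes/RungOne/Lines/Sketch.lean`.)

**Theorem** (`AnnulusTwist.exists_iso_rel_smallDisc`). Let `ψ` be a diffeomorphism of `ℝ²`
(smooth with smooth inverse `ψ'`) equal to the identity on the disc `‖z‖ ≤ 5/4` and off the disc
of radius `7/4`.  Then for some integer `k`, some scale `0 < λ ≤ 1` and some radius `δ > 0`, the
rescaled diffeomorphism `ψ_λ = δ_λ ψ δ_λ⁻¹` is joined to the `k`-th Dehn twist power
`twist (2πk)` (layer 1) by a jointly smooth family `F_t` of diffeomorphisms of `ℝ²`, all equal to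
the identity on the disc of radius `δ` and off the disc of radius `7/4`.

**Proof** — the homotopy sequence of the fibration `Diff_c(ℝ²) → Emb(D², ℝ²)` made concrete, as in
the tree's proof of the injectivity half of Cerf's Proposition 4 (`CerfPropositionFourInjective.lean`;
Cerf, LNM 53 (1968), Appendice §5, Prop. 4), with Smale's theorem (`π₀ Diff_c(ℝ²) = 0`) as input:
1. (layer 2) Smale's theorem at a small scale `μ` gives a jointly smooth family `D_t` of compactly
   supported diffeomorphisms from `id` to `ψ_λ`, `λ = 4μ/7`; the scale is chosen so small that the
   centre `c_t = D_t 0` (`‖c_t‖ < μ`) is followed by the explicit **translation loop**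
   `T_t = id + θ • c_t` (`θ` a fixed bump, `‖D(θ • c_t)‖ ≤ 1/2`; tree `exists_familyDiffeotopy`);
2. (layer 3) the direction of `D(D_t)(0) e₀` has a smooth angle `α` from `0` to `2πk`, and the cap
   rotations `R_t = capRot (α t)` (layer 1) form an explicit family from `id` to
   `capRot (2πk) = twist (-2πk)`;
3. the corrected family `E_t = R_t⁻¹ ∘ T_t⁻¹ ∘ D_t` fixes `0`, is a based loop of GERMS at `0`
   (`ψ_λ = id` near `0`), with `1`-jet `R(-α t) D(D_t)(0)` upper triangular positive; by the loop
   realisation theorem (`exists_diffeotopy_loopRealisation`, `LoopRealisation.lean`) there is a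
   LOOP `L_t` of compactly supported diffeomorphisms with `L_t = E_t` on a small disc;
4. `H_t = L_t⁻¹ ∘ E_t` fixes that small disc pointwise and runs from `id` to
   `H_1 = E_1 = twist (2πk) ∘ ψ_λ`; so `F_t = twist (-2πk) ∘ H_t` runs from `twist (-2πk)` to `ψ_λ`
   rel the small disc (and rel `‖z‖ ≥ 7/4`, where every map involved is the identity).

## References

* J. Cerf, *Sur les difféomorphismes de la sphère de dimension trois (Γ₄ = 0)*, LNM 53 (1968),
  Appendice §5, Proposition 4, Théorème 4. [CerfDiffeoSphere1968]
* S. Smale, *Diffeomorphisms of the 2-sphere*, Proc. AMS 10 (1959) 621–626. [Smale1959]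
* B. Farb, D. Margalit, *A primer on mapping class groups* (2012), Prop. 2.4 (the homotopy form),
  §3.1.1. [FarbMargalit2012]
-/

set_option linter.dupNamespace false

noncomputable section

open scoped ContDiff Topology Real Manifold
open Set Function Metric Filter Literature.Topology.FourManifolds

namespace Summit.SmoothPoincare4.SmoothPoincare4.Cruxes.RungOne.Sketch

namespace AnnulusTwist

/-! ### A bump equal to `1` near the origin, and the bound on its gradient -/

/-- A smooth radial profile `z ↦ 1 - smoothTransition (4 (‖z‖ - 1/4))`: `1` on `‖z‖ ≤ 1/4`, `0`
outside `1/2`, smooth, with bounded derivative. [folklore] -/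
theorem exists_bump : ∃ (θ : EuclideanSpace ℝ (Fin 2) → ℝ) (C : ℝ), ContDiff ℝ ∞ θ ∧ 0 < C ∧
    (∀ z, ‖z‖ ≤ 1 / 4 → θ z = 1) ∧ (∀ z, 1 / 2 ≤ ‖z‖ → θ z = 0) ∧ ∀ z, ‖fderiv ℝ θ z‖ ≤ C := by
  set θ : EuclideanSpace ℝ (Fin 2) → ℝ := fun z => 1 - Real.smoothTransition (4 * (‖z‖ - 1 / 4))
    with hθ
  have hle : ∀ z : EuclideanSpace ℝ (Fin 2), ‖z‖ ≤ 1 / 4 → θ z = 1 := fun z hz => by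
    simp only [hθ, Real.smoothTransition.zero_of_nonpos (show 4 * (‖z‖ - 1 / 4) ≤ 0 by linarith)]
    ring
  have hge : ∀ z : EuclideanSpace ℝ (Fin 2), 1 / 2 ≤ ‖z‖ → θ z = 0 := fun z hz => by
    simp only [hθ, Real.smoothTransition.one_of_one_le (show 1 ≤ 4 * (‖z‖ - 1 / 4) by linarith)]
    ring
  have hsmooth : ContDiff ℝ ∞ θ := by
    refine contDiff_iff_contDiffAt.2 fun z => ?_
    by_cases hz : ‖z‖ < 1 / 4
    · have hev : θ =ᶠ[𝓝 z] fun _ => 1 := by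
        filter_upwards [Metric.isOpen_ball.mem_nhds (mem_ball_zero_iff.2 hz)] with w hw
        exact hle w (mem_ball_zero_iff.1 hw).le
      exact contDiffAt_const.congr_of_eventuallyEq hev
    · have hz0 : z ≠ 0 := by rintro rfl; exact hz (by rw [norm_zero]; norm_num)
      exact contDiffAt_const.sub (Real.smoothTransition.contDiff.contDiffAt.comp z
        (contDiffAt_const.mul ((contDiffAt_norm ℝ hz0).sub contDiffAt_const)))
  -- the derivative is continuous and vanishes off the unit ball, hence is bounded
  have hcont : Continuous (fderiv ℝ θ) := hsmooth.continuous_fderiv (by simp)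
  obtain ⟨C₀, hC₀⟩ := (isCompact_closedBall (0 : EuclideanSpace ℝ (Fin 2)) 1).exists_bound_of_continuousOn
    hcont.continuousOn
  have hout : ∀ z : EuclideanSpace ℝ (Fin 2), 1 < ‖z‖ → fderiv ℝ θ z = 0 := fun z hz => by
    have hev : θ =ᶠ[𝓝 z] fun _ => 0 := by
      have ho : IsOpen {w : EuclideanSpace ℝ (Fin 2) | 1 / 2 < ‖w‖} := isOpen_lt continuous_const continuous_norm
      filter_upwards [ho.mem_nhds (show (1 : ℝ) / 2 < ‖z‖ by linarith)] with w hw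
      exact hge w (le_of_lt hw)
    rw [hev.fderiv_eq]; exact fderiv_const_apply 0
  refine ⟨θ, max C₀ 1, hsmooth, lt_max_of_lt_right one_pos, hle, hge, fun z => ?_⟩
  by_cases hz : ‖z‖ ≤ 1
  · exact (hC₀ z (mem_closedBall_zero_iff.2 hz)).trans (le_max_left _ _)
  · rw [hout z (not_le.1 hz), norm_zero]; positivity

/-! ### The main construction -/

/-- **A diffeomorphism of the annulus, rescaled, is isotopic to a Dehn twist power rel a small
disc** (see the module docstring for the statement and the proof).
[cite: CerfDiffeoSphere1968, Appendice §5, Proposition 4] -/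
theorem exists_iso_rel_smallDisc (ψ ψ' : EuclideanSpace ℝ (Fin 2) → EuclideanSpace ℝ (Fin 2))
    (hψ : ContDiff ℝ ∞ ψ) (hψ' : ContDiff ℝ ∞ ψ') (h1 : ∀ z, ψ (ψ' z) = z) (h2 : ∀ z, ψ' (ψ z) = z)
    (hfix : ∀ z, ‖z‖ ≤ 5 / 4 → ψ z = z) (hsupp : ∀ z, 7 / 4 ≤ ‖z‖ → ψ z = z) :
    ∃ (k : ℤ) (l δ : ℝ) (F Finv : ℝ → EuclideanSpace ℝ (Fin 2) → EuclideanSpace ℝ (Fin 2)),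
      0 < l ∧ l ≤ 1 ∧ 0 < δ ∧ δ ≤ 1 ∧
      ContDiff ℝ ∞ (uncurry F) ∧ ContDiff ℝ ∞ (uncurry Finv) ∧
      (∀ t z, F t (Finv t z) = z) ∧ (∀ t z, Finv t (F t z) = z) ∧
      (∀ z, F 0 z = twist (2 * π * k) z) ∧ (∀ z, F 1 z = l • ψ (l⁻¹ • z)) ∧
      (∀ t z, ‖z‖ ≤ δ → F t z = z) ∧ (∀ t z, 7 / 4 ≤ ‖z‖ → F t z = z) := by
  -- Step 0: the bump and the scale
  obtain ⟨θ, C, hθ, hC, hθ1, hθ0, hθC⟩ := exists_bump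
  set μ : ℝ := min (1 / 4) (1 / (4 * C)) with hμ
  have hμpos : 0 < μ := lt_min (by norm_num) (by positivity)
  have hμle : μ ≤ 1 / 4 := min_le_left _ _
  have hμC : μ * C ≤ 1 / 4 := by
    have : μ ≤ 1 / (4 * C) := min_le_right _ _
    rw [le_div_iff₀ (by positivity)] at this
    linarith
  set l : ℝ := 4 * μ / 7 with hl
  have hlpos : 0 < l := by positivity
  have hl1 : l ≤ 1 := by rw [hl]; linarith
  -- Step 1: Smale's theorem at scale `μ`
  obtain ⟨D, Dinv, hD, hDinv, hDDinv, hDinvD, hD0, hD1, hDsupp⟩ :=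
    exists_smale_family ψ ψ' hψ hψ' h1 h2 hsupp hμpos
  have hDt : ∀ t, ContDiff ℝ ∞ (D t) := fun t => hD.comp (contDiff_prodMk_right t)
  have hDinj : ∀ t, Injective (D t) := fun t x y hxy => by
    rw [← hDinvD t x, hxy, hDinvD]
  -- the centre `c t = D t 0`
  set c : ℝ → EuclideanSpace ℝ (Fin 2) := fun t => D t 0 with hc
  have hcs : ContDiff ℝ ∞ c := hD.comp (contDiff_id.prodMk contDiff_const)
  have hcμ : ∀ t, ‖c t‖ < μ := fun t => by
    by_contra hge
    have h := hDsupp t (c t) (not_lt.1 hge)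
    have : c t = 0 := hDinj t h
    rw [this, norm_zero] at hge
    exact hge hμpos
  have hc0 : ∀ t, t ≤ 0 ∨ 1 ≤ t → c t = 0 := by
    rintro t (ht | ht)
    · exact hD0 t ht 0
    · simp only [hc, hD1 t ht, smul_zero, hfix 0 (by rw [norm_zero]; norm_num)]
  -- `D t` is the identity near `0` for `t ≥ 1`
  have hD1fix : ∀ t, (1 : ℝ) ≤ t → ∀ z : EuclideanSpace ℝ (Fin 2), ‖z‖ ≤ l → D t z = z := by
    intro t ht z hz
    rw [hD1 t ht, hfix, smul_smul, mul_inv_cancel₀ hlpos.ne', one_smul]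
    rw [norm_smul, Real.norm_eq_abs, abs_inv, abs_of_pos hlpos, inv_mul_le_iff₀ hlpos]
    linarith
  have hD1ev : ∀ t, (1 : ℝ) ≤ t → ∀ᶠ z in 𝓝 (0 : EuclideanSpace ℝ (Fin 2)), D t z = z := fun t ht => by
    filter_upwards [Metric.closedBall_mem_nhds (0 : EuclideanSpace ℝ (Fin 2)) hlpos] with z hz
    exact hD1fix t ht z (mem_closedBall_zero_iff.1 hz)
  -- Step 2: the translation loop `T_t = id + θ • c_t`
  set p : ℝ → EuclideanSpace ℝ (Fin 2) → EuclideanSpace ℝ (Fin 2) := fun t z => θ z • c t with hp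
  have hps : ContDiff ℝ ∞ (uncurry p) := (hθ.comp contDiff_snd).smul (hcs.comp contDiff_fst)
  have hpb : ∀ t y, ‖fderiv ℝ (p t) y‖ ≤ 1 / 2 := fun t y => by
    have : fderiv ℝ (p t) y = (fderiv ℝ θ y).smulRight (c t) :=
      fderiv_smul_const ((hθ.differentiable (by simp)) y) (c t)
    rw [this, ContinuousLinearMap.norm_smulRight_apply]
    calc ‖fderiv ℝ θ y‖ * ‖c t‖ ≤ C * μ :=
          mul_le_mul (hθC y) (hcμ t).le (norm_nonneg _) hC.le
      _ ≤ 1 / 2 := by linarith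
  have hp0 : ∀ y, p 0 y = 0 := fun y => by simp only [hp, hc0 0 (Or.inl le_rfl), smul_zero]
  obtain ⟨T, hT⟩ := exists_familyDiffeotopy hps hpb hp0
  obtain ⟨hTs, hTinvs⟩ := contDiff_of_diffeotopy T
  have hTid : ∀ t, t ≤ 0 ∨ 1 ≤ t → ∀ y, T.toFun t y = y := fun t ht y => by
    rw [hT, hp]; simp only [hc0 t ht, smul_zero, add_zero]
  have hTinvid : ∀ t, t ≤ 0 ∨ 1 ≤ t → ∀ y, T.invFun t y = y := fun t ht y => by
    conv_lhs => rw [← hTid t ht y]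
    exact T.invFun_toFun t y
  have hTfar : ∀ t y, 1 / 2 ≤ ‖y‖ → T.toFun t y = y := fun t y hy => by
    rw [hT, hp]; simp only [hθ0 y hy, zero_smul, add_zero]
  have hTinvfar : ∀ t y, 1 / 2 ≤ ‖y‖ → T.invFun t y = y := fun t y hy => by
    conv_lhs => rw [← hTfar t y hy]
    exact T.invFun_toFun t y
  have hTnear : ∀ t y, ‖y‖ ≤ 1 / 4 → T.toFun t y = y + c t := fun t y hy => by
    rw [hT, hp]; simp only [hθ1 y hy, one_smul]
  have hT0 : ∀ t, T.toFun t 0 = c t := fun t => by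
    rw [hTnear t 0 (by rw [norm_zero]; norm_num), zero_add]
  have hTinv_c : ∀ t, T.invFun t (c t) = 0 := fun t => by
    conv_lhs => rw [← hT0 t]
    exact T.invFun_toFun t 0
  have hTinv_near : ∀ t, ∀ w, ‖w - c t‖ ≤ 1 / 4 → T.invFun t w = w - c t := fun t w hw => by
    have := hTnear t (w - c t) hw
    rw [sub_add_cancel] at this
    conv_lhs => rw [← this]
    exact T.invFun_toFun t _
  have hfderiv_Tinv : ∀ t, fderiv ℝ (T.invFun t) (c t) = ContinuousLinearMap.id ℝ _ := fun t => by
    have hev : T.invFun t =ᶠ[𝓝 (c t)] fun w => w - c t := by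
      filter_upwards [Metric.closedBall_mem_nhds (c t) (by norm_num : (0 : ℝ) < 1 / 4)] with w hw
      exact hTinv_near t w (by rwa [mem_closedBall, dist_eq_norm] at hw)
    rw [hev.fderiv_eq, fderiv_sub_const, fderiv_fun_id]
  -- Step 3: the angle `α` and the cap rotations
  obtain ⟨α, k, hαs, hα0, hα1, hunit, -⟩ := exists_angle hD hDinv hDinvD hD0 hD1ev
  -- Step 4: the corrected family `E_t = capRot (-α t) ∘ T_t⁻¹ ∘ D_t`, a based loop of germs
  set E : ℝ → EuclideanSpace ℝ (Fin 2) → EuclideanSpace ℝ (Fin 2) :=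
    fun t z => capRot (-α t) (T.invFun t (D t z)) with hE
  have hEs : ContDiff ℝ ∞ (uncurry E) := by
    refine ContDiff.capRot (hαs.comp contDiff_fst).neg ?_
    exact hTinvs.comp (contDiff_fst.prodMk hD)
  have hE0 : ∀ t, E t 0 = 0 := fun t => by
    simp only [hE]; rw [show D t 0 = c t from rfl, hTinv_c, capRot_apply_zero]
  have hEle : ∀ t ≤ (0 : ℝ), ∀ y, E t y = y := fun t ht y => by
    simp only [hE, hD0 t ht, hTinvid t (Or.inl ht), hα0 t ht, neg_zero, capRot_zero]
  have hEge : ∀ t, (1 : ℝ) ≤ t → ∀ y : EuclideanSpace ℝ (Fin 2), ‖y‖ ≤ l → E t y = y := by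
    intro t ht y hy
    have hy' : ‖y‖ ≤ 5 / 4 := by linarith
    simp only [hE, hD1fix t ht y hy, hTinvid t (Or.inr ht), hα1 t ht]
    rw [capRot_of_le _ hy', show -(2 * π * (k : ℝ)) = 2 * π * ((-k : ℤ) : ℝ) by push_cast; ring,
      rotL_two_pi_mul_int]
  have hEfderiv : ∀ t, fderiv ℝ (E t) 0 = (rotL (-α t)).comp (fderiv ℝ (D t) 0) := fun t => by
    have hd1 : DifferentiableAt ℝ (D t) 0 := (hDt t).differentiable (by simp) 0
    have hd2 : DifferentiableAt ℝ (T.invFun t) (D t 0) :=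
      ((hTinvs.comp (contDiff_prodMk_right t)).differentiable (by simp)) _
    have hd3 : DifferentiableAt ℝ (capRot (-α t)) (T.invFun t (D t 0)) :=
      ((contDiff_capRot.comp (contDiff_prodMk_right (-α t))).differentiable (by simp)) _
    have hcomp : E t = capRot (-α t) ∘ (T.invFun t ∘ D t) := rfl
    rw [hcomp, fderiv_comp 0 hd3 (hd2.comp 0 hd1), fderiv_comp 0 hd2 hd1]
    simp only [Function.comp_apply]
    rw [show T.invFun t (D t 0) = 0 from hTinv_c t, fderiv_capRot_zero,
      show D t 0 = c t from rfl, hfderiv_Tinv]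
    ext1 x; rfl
  -- Step 5: loop realisation
  obtain ⟨L, δ, hδ, hLE, hLfar, hLid⟩ := exists_diffeotopy_loopRealisation (E := EuclideanSpace ℝ (Fin 2))
    hlpos (hEs.contDiffOn) hE0
    (fun t ht y _ => hEle t ht y) (fun t ht y hy => hEge t ht y (mem_ball_zero_iff.1 hy).le)
    (fun t _ s hs => by rw [hEfderiv]; exact hunit t s hs) one_pos
  obtain ⟨hLs, hLinvs⟩ := contDiff_of_diffeotopy L
  have hLinvid : ∀ t, t ≤ 0 ∨ 1 ≤ t → ∀ y, L.invFun t y = y := fun t ht y => by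
    conv_lhs => rw [← show L.toFun t y = y by rw [hLid t ht]; rfl]
    exact L.invFun_toFun t y
  have hLinvfar : ∀ t y, 1 ≤ ‖y‖ → L.invFun t y = y := fun t y hy => by
    conv_lhs => rw [← hLfar t y hy]
    exact L.invFun_toFun t y
  -- Step 6: `H_t = L_t⁻¹ ∘ E_t` and `F_t = twist (-2πk) ∘ H_t`
  set H : ℝ → EuclideanSpace ℝ (Fin 2) → EuclideanSpace ℝ (Fin 2) := fun t z => L.invFun t (E t z)
    with hH
  set Hinv : ℝ → EuclideanSpace ℝ (Fin 2) → EuclideanSpace ℝ (Fin 2) :=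
    fun t z => Dinv t (T.toFun t (capRot (α t) (L.toFun t z))) with hHinv
  have hHs : ContDiff ℝ ∞ (uncurry H) := hLinvs.comp (contDiff_fst.prodMk hEs)
  have hHinvs : ContDiff ℝ ∞ (uncurry Hinv) := by
    have h3 : ContDiff ℝ ∞ fun q : ℝ × EuclideanSpace ℝ (Fin 2) => capRot (α q.1) (L.toFun q.1 q.2) :=
      ContDiff.capRot (hαs.comp contDiff_fst) hLs
    have h4 : ContDiff ℝ ∞ fun q : ℝ × EuclideanSpace ℝ (Fin 2) =>
        T.toFun q.1 (capRot (α q.1) (L.toFun q.1 q.2)) := hTs.comp (contDiff_fst.prodMk h3)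
    exact hDinv.comp (contDiff_fst.prodMk h4)
  have hHHinv : ∀ t z, H t (Hinv t z) = z := fun t z => by
    simp only [hH, hHinv, hE, hDDinv, Diffeotopy.invFun_toFun, capRot_neg_capRot]
  have hHinvH : ∀ t z, Hinv t (H t z) = z := fun t z => by
    simp only [hH, hHinv, hE, Diffeotopy.toFun_invFun, capRot_capRot_neg, hDinvD]
  refine ⟨-k, l, min δ 1, fun t z => twist (-(2 * π * k)) (H t z),
    fun t z => Hinv t (twist (2 * π * k) z), hlpos, hl1, lt_min hδ one_pos, min_le_right _ _,
    ?_, ?_, ?_, ?_, ?_, ?_, ?_, ?_⟩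
  · exact ContDiff.twist contDiff_const hHs
  · exact hHinvs.comp (contDiff_fst.prodMk (ContDiff.twist contDiff_const contDiff_snd))
  · intro t z; simp only [hHHinv, twist_neg_twist]
  · intro t z; simp only [twist_twist_neg, hHinvH]
  · intro z
    simp only [hH, hLinvid 0 (Or.inl le_rfl), hEle 0 le_rfl]
    congr 1; push_cast; ring
  · intro z
    have hE1 : E 1 z = twist (2 * π * k) (D 1 z) := by
      simp only [hE, hTinvid 1 (Or.inr le_rfl), hα1 1 le_rfl]
      rw [show -(2 * π * (k : ℝ)) = 2 * π * ((-k : ℤ) : ℝ) by push_cast; ring, capRot_two_pi_mul_int]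
      congr 1; push_cast; ring
    simp only [hH, hLinvid 1 (Or.inr le_rfl), hE1, twist_neg_twist, hD1 1 le_rfl, hl]
  · intro t z hz
    have hz1 : ‖z‖ ≤ δ := hz.trans (min_le_left _ _)
    have hHz : H t z = z := by
      simp only [hH]
      rw [← hLE t z (mem_closedBall_zero_iff.2 hz1), L.invFun_toFun]
    show twist (-(2 * π * k)) (H t z) = z
    rw [hHz, twist_of_le _ (by linarith [hz.trans (min_le_right δ 1)])]
  · intro t z hz
    have hz' : (1 : ℝ) ≤ ‖z‖ := by linarith
    have hEz : E t z = z := by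
      simp only [hE, hDsupp t z (by linarith), hTinvfar t z (by linarith), capRot_of_ge _ hz]
    have hHz : H t z = z := by simp only [hH, hEz, hLinvfar t z hz']
    show twist (-(2 * π * k)) (H t z) = z
    rw [hHz, twist_of_ge _ hz, show -(2 * π * (k : ℝ)) = 2 * π * ((-k : ℤ) : ℝ) by push_cast; ring,
      rotL_two_pi_mul_int]

end AnnulusTwist

/-- **Registered sub-helper `helper_ann_core`** (layer 4 of `helper_sliceGluing_annulusTwist`):
a diffeomorphism of the annulus `5/4 ≤ ‖z‖ ≤ 7/4` fixed near its boundary, rescaled by some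
`λ ∈ (0, 1]`, is isotopic rel a small disc and rel `‖z‖ ≥ 7/4` to a Dehn twist power
(`AnnulusTwist.exists_iso_rel_smallDisc`, with the twist written out).
[cite: CerfDiffeoSphere1968, Appendice §5, Proposition 4] -/
theorem helper_ann_core : ∀ (ψ ψ' : EuclideanSpace ℝ (Fin 2) → EuclideanSpace ℝ (Fin 2)), ContDiff ℝ ∞ ψ → ContDiff ℝ ∞ ψ' → (∀ z, ψ (ψ' z) = z) → (∀ z, ψ' (ψ z) = z) → (∀ z, ‖z‖ ≤ 5 / 4 → ψ z = z) → (∀ z, 7 / 4 ≤ ‖z‖ → ψ z = z) → ∃ (k : ℤ) (l δ : ℝ) (F Finv : ℝ → EuclideanSpace ℝ (Fin 2) → EuclideanSpace ℝ (Fin 2)), 0 < l ∧ l ≤ 1 ∧ 0 < δ ∧ δ ≤ 1 ∧ ContDiff ℝ ∞ (Function.uncurry F) ∧ ContDiff ℝ ∞ (Function.uncurry Finv) ∧ (∀ t z, F t (Finv t z) = z) ∧ (∀ t z, Finv t (F t z) = z) ∧ (∀ z, (F 0 z) 0 = Real.cos (2 * Real.pi * k * Real.smoothTransition (2 * (‖z‖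 - 5 / 4))) * z 0 - Real.sin (2 * Real.pi * k * Real.smoothTransition (2 * (‖z‖ - 5 / 4))) * z 1 ∧ (F 0 z) 1 = Real.sin (2 * Real.pi * k * Real.smoothTransition (2 * (‖z‖ - 5 / 4))) * z 0 + Real.cos (2 * Real.pi * k * Real.smoothTransition (2 * (‖z‖ - 5 / 4))) * z 1) ∧ (∀ z, F 1 z = l • ψ (l⁻¹ • z)) ∧ (∀ t z, ‖z‖ ≤ δ → F t z = z) ∧ (∀ t z, 7 / 4 ≤ ‖z‖ → F t z = z) := by
  intro ψ ψ' hψ hψ' h1 h2 hfix hsupp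
  obtain ⟨k, l, δ, F, Finv, hl, hl1, hδ, hδ1, hFs, hFis, hFa, hFb, hF0, hF1, hFfix, hFfar⟩ :=
    AnnulusTwist.exists_iso_rel_smallDisc ψ ψ' hψ hψ' h1 h2 hfix hsupp
  refine ⟨k, l, δ, F, Finv, hl, hl1, hδ, hδ1, hFs, hFis, hFa, hFb, fun z => ?_, hF1, hFfix, hFfar⟩
  rw [hF0]
  exact AnnulusTwist.twist_apply_coord _ z

end Summit.SmoothPoincare4.SmoothPoincare4.Cruxes.RungOne.Sketch

end
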